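import Literature.NumberTheory.LFunctions.JensenTuranCriterion
import HarnessLib

/-!
# The Hermite inversion formula and GORTTW's Hermite coefficients `c_{d,n,j}` (DLMF 18.18.20; GORTTW 2022, (2.7)) — proved

Topic `Literature/NumberTheory/LFunctions`, companion of `JensenTuranCriterion.lean`. Turán's criterion
(`exists_eq_prod_of_turanSum_lt_one`) takes a polynomial written in the Hermite basis
`∑_j a_j H_{d-j}(X/2)`; Griffin–Ono–Rolen–Thorner–Tripp–Wagner apply it to the normalised Jensen
polynomial written in the MONOMIAL basis, `J̃^{d,n}(X) = ∑_{k=0}^{d} A_{d,k}(n) X^{d-k}`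
[GriffinEtAl2022, (2.6)], passing to the Hermite basis by "the inversion formula [DLMF]"
[GriffinEtAl2022, proof of Lemma 2.4]:

* **inversion formula** (DLMF 18.18.20, `(2x)^n = ∑_{ℓ≤n/2} ((-n)_{2ℓ}/ℓ!) H_{n-2ℓ}(x)`,
  `(-n)_{2ℓ} = n!/(n-2ℓ)!`), here
  in GORZ's normalisation `gorzHermite m = H_m(X/2)` (monic), where it reads
  `X^n = n! ∑_{k ≤ n/2} gorzHermite (n-2k) / (k! (n-2k)!)`:
  `Literature.NumberTheory.LFunctions.X_pow_eq_sum_gorzHermite`, with the coefficient of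
  `gorzHermite j` packaged as `hermiteInvCoeff n j` (`= n!/(((n-j)/2)! j!)` if `j ≤ n`, `n - j` even,
  else `0`);
* **GORTTW (2.7)**: `∑_{k≤d} A_k X^{d-k} = ∑_{j≤d} c_j H_{d-j}(X/2)` with
  `c_j = ∑_{i ≤ j/2} (d-j+2i)!/(i!(d-j)!) · A_{j-2i}` — here
  `Literature.NumberTheory.LFunctions.sum_C_mul_X_pow_eq_sum_gorzHermite` with
  `c_j = monomialToHermite d A j := ∑_{k≤d} hermiteInvCoeff (d-k) (d-j) · A_k` (only the terms
  `k = j - 2i` are nonzero, and `hermiteInvCoeff (d-j+2i) (d-j) = (d-j+2i)!/(i!(d-j)!)`, so this IS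
  (2.7)); `monomialToHermite_zero/_one/_two` give `c₀ = A₀`, `c₁ = A₁`, `c₂ = A₂ + d(d-1)A₀`
  (so `A₀ = 1`, `A₂ = -d(d-1)` ⇒ `c₀ = 1`, `c₂ = 0`, cf. [GriffinEtAl2022, Lemma 2.2]);
* **GORTTW Lemma 2.4, monomial-input form**:
  `Literature.NumberTheory.LFunctions.exists_eq_prod_of_turanSum_monomial_lt_one` — if `A₀ = 1`,
  `A₂ = -d(d-1)` and `∑_{j=3}^{d} 2^{-j}(d-j)!/(d-1)! c_j² < 1` (`turanSum d c < 1`) then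
  `∑_{k≤d} A_k X^{d-k} = ∏_{i<d} (X - tᵢ)` with `t₀ < ⋯ < t_{d-1}` (hyperbolic, simple zeros).

All statements are theorems (no named facts). Not here: the definition of `A_{d,k}(n)` through the
uniformizer `Δ(n+d)` [GriffinEtAl2022, (2.3), (2.6)] and the affine map `J̃^{d,n} ↔ J^{d,n}`.

## References
* [GriffinEtAl2022] Griffin–Ono–Rolen–Thorner–Tripp–Wagner, Adv. Math. 397 (2022) 108186 =
  arXiv:1910.01227v3: (2.6), (2.7), Lemma 2.2, Lemma 2.4 and its proof ("inversion formula [DLMF]").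
* [DLMF] NIST Digital Library of Mathematical Functions, §18.18, eq. 18.18.20 as printed:
  `(2x)^n = ∑_{ℓ=0}^{⌊n/2⌋} ((-n)_{2ℓ}/ℓ!) H_{n-2ℓ}(x)`, where `(-n)_{2ℓ} = n!/(n-2ℓ)!`.
* [Szego1975] G. Szegő, *Orthogonal Polynomials*, §5.5 (Hermite polynomials).
-/

noncomputable section

open Polynomial Finset
open scoped Nat

namespace Literature.NumberTheory.LFunctions

/-! ### The inversion coefficients -/

/-- The coefficient of `gorzHermite j = H_j(X/2)` in `X^n`: `n!/(((n-j)/2)! · j!)` when `j ≤ n` and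
`n - j` is even, `0` otherwise (DLMF 18.18.20 in GORZ's normalisation; the `2^{-n}` of DLMF is
absorbed by `X ↦ X/2`). [cite: DLMF, 18.18.20] -/
def hermiteInvCoeff (n j : ℕ) : ℝ :=
  if j ≤ n ∧ Even (n - j) then (n ! : ℝ) / ((((n - j) / 2)! : ℝ) * (j ! : ℝ)) else 0

/-- `hermiteInvCoeff n j = 0` for `j > n`. [folklore] -/
private lemma hermiteInvCoeff_of_lt {n j : ℕ} (h : n < j) : hermiteInvCoeff n j = 0 := by
  simp [hermiteInvCoeff, show ¬ j ≤ n from by omega]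

/-- `hermiteInvCoeff n n = 1`. [folklore] -/
private lemma hermiteInvCoeff_self (n : ℕ) : hermiteInvCoeff n n = 1 := by
  have h0 : (n ! : ℝ) ≠ 0 := by positivity
  simp [hermiteInvCoeff, h0]

/-- The recursion behind `X · X^n = X^{n+1}` in the Hermite basis:
`b(n+1, i) = [i ≥ 1] b(n, i-1) + 2(i+1) b(n, i+1)`. [folklore] -/
private lemma hermiteInvCoeff_succ (n i : ℕ) :
    hermiteInvCoeff (n + 1) i =
      (if i = 0 then 0 else hermiteInvCoeff n (i - 1)) + 2 * ((i : ℝ) + 1) * hermiteInvCoeff n (i + 1) := by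
  rcases Nat.eq_zero_or_pos i with rfl | hi
  · -- i = 0
    simp only [↓reduceIte, zero_add, Nat.cast_zero, hermiteInvCoeff, Nat.zero_le, true_and,
      Nat.sub_zero, Nat.factorial_zero, Nat.cast_one, mul_one]
    by_cases he : Even (n + 1)
    · obtain ⟨s, hs⟩ := he
      have hs1 : 1 ≤ s := by omega
      have hn1 : 1 ≤ n := by omega
      have hodd : Even (n - 1) := ⟨s - 1, by omega⟩
      rw [if_pos ⟨s, hs⟩, if_pos ⟨hn1, hodd⟩]
      have e1 : (n + 1) / 2 = s := by omega
      have e2 : (n - 1) / 2 = s - 1 := by omega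
      rw [e1, e2, Nat.factorial_succ, Nat.factorial_one]
      obtain ⟨r, rfl⟩ : ∃ r, s = r + 1 := ⟨s - 1, by omega⟩
      rw [Nat.add_sub_cancel, Nat.factorial_succ]
      have hr : ((r + 1 : ℕ) : ℝ) ≠ 0 := by positivity
      have hrf : ((r ! : ℕ) : ℝ) ≠ 0 := by positivity
      have hn : (n : ℝ) + 1 = 2 * ((r : ℝ) + 1) := by
        have : n + 1 = 2 * (r + 1) := by omega
        exact_mod_cast this
      push_cast
      field_simp
      push_cast [hn]
      ring
    · rw [if_neg he]
      have : ¬ (1 ≤ n ∧ Even (n - 1)) := by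
        rintro ⟨h1, ⟨s, hs⟩⟩; exact he ⟨s + 1, by omega⟩
      rw [if_neg this]; simp
  · -- i ≥ 1 : write i = i' + 1
    obtain ⟨i', rfl⟩ : ∃ i', i = i' + 1 := ⟨i - 1, by omega⟩
    simp only [Nat.add_one_ne_zero, ↓reduceIte, Nat.add_sub_cancel]
    unfold hermiteInvCoeff
    have esub : n + 1 - (i' + 1) = n - i' := by omega
    rw [esub]
    by_cases hle : i' ≤ n
    · by_cases he : Even (n - i')
      · obtain ⟨s, hs⟩ := he
        have e1 : (n - i') / 2 = s := by omega
        rw [if_pos ⟨by omega, ⟨s, hs⟩⟩, if_pos ⟨hle, ⟨s, hs⟩⟩, e1]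
        rcases Nat.eq_zero_or_pos s with rfl | hs1
        · -- s = 0 : i' = n
          have hin : i' = n := by omega
          subst hin
          rw [if_neg (by omega)]
          have h1 : ((i' + 1)! : ℝ) ≠ 0 := by positivity
          have h2 : (i' ! : ℝ) ≠ 0 := by positivity
          simp [h1, h2]
        · have hle2 : i' + 1 + 1 ≤ n := by omega
          have he2 : Even (n - (i' + 1 + 1)) := ⟨s - 1, by omega⟩
          have e2 : (n - (i' + 1 + 1)) / 2 = s - 1 := by omega
          rw [if_pos ⟨hle2, he2⟩, e2]
          obtain ⟨r, rfl⟩ : ∃ r, s = r + 1 := ⟨s - 1, by omega⟩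
          rw [Nat.add_sub_cancel]
          have hn : (n : ℝ) = (i' : ℝ) + 2 * ((r : ℝ) + 1) := by
            have : n = i' + 2 * (r + 1) := by omega
            exact_mod_cast this
          have f1 : ((n + 1)! : ℝ) = ((n : ℝ) + 1) * (n ! : ℝ) := by
            rw [Nat.factorial_succ]; push_cast; ring
          have f2 : ((r + 1)! : ℝ) = ((r : ℝ) + 1) * (r ! : ℝ) := by
            rw [Nat.factorial_succ]; push_cast; ring
          have f3 : ((i' + 1 + 1)! : ℝ) = ((i' : ℝ) + 2) * (((i' : ℝ) + 1) * (i' ! : ℝ)) := by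
            rw [Nat.factorial_succ, Nat.factorial_succ]; push_cast; ring
          have f4 : ((i' + 1)! : ℝ) = ((i' : ℝ) + 1) * (i' ! : ℝ) := by
            rw [Nat.factorial_succ]; push_cast; ring
          rw [f1, f2, f3, f4]
          have hr : (r ! : ℝ) ≠ 0 := by positivity
          have hi : (i' ! : ℝ) ≠ 0 := by positivity
          have hn0 : (n ! : ℝ) ≠ 0 := by positivity
          field_simp
          push_cast
          rw [hn]
          ring
      · -- n - i' odd : everything vanishes
        rw [if_neg (fun h => he h.2), if_neg (fun h => he h.2)]
        by_cases hle2 : i' + 1 + 1 ≤ n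
        · have : ¬ Even (n - (i' + 1 + 1)) := by
            rintro ⟨s, hs⟩; exact he ⟨s + 1, by omega⟩
          rw [if_neg (fun h => this h.2)]; simp
        · rw [if_neg (fun h => hle2 h.1)]; simp
    · -- i' > n
      rw [if_neg (fun h => by omega), if_neg (fun h => hle h.1), if_neg (fun h => by omega)]
      simp

/-- `X · H_j(X/2) = H_{j+1}(X/2) + 2j H_{j-1}(X/2)` (the three-term recurrence of `gorzHermite`,
valid for all `j`, the last term being absent for `j = 0`). [folklore] -/
private lemma X_mul_gorzHermite (j : ℕ) :
    X * gorzHermite j = gorzHermite (j + 1) + C (2 * (j : ℝ)) * gorzHermite (j - 1) := by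
  rcases j with _ | k
  · simp
  · rw [show k + 1 + 1 = k + 2 from rfl, gorzHermite_add_two, Nat.add_sub_cancel]
    push_cast
    ring

/-- **Inversion formula** (DLMF 18.18.20 in GORZ's normalisation):
`X^n = ∑_{j ≤ n} b(n,j) · H_j(X/2)` with `b(n,j) = hermiteInvCoeff n j = n!/(((n-j)/2)! j!)` for
`n - j` even (else `0`), i.e. `X^n = n! ∑_{k≤n/2} H_{n-2k}(X/2)/(k!(n-2k)!)` — "the inversion formula
[DLMF]" of [GriffinEtAl2022, proof of Lemma 2.4]. [cite: DLMF, 18.18.20] -/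
theorem X_pow_eq_sum_gorzHermite (n : ℕ) :
    (X : ℝ[X]) ^ n = ∑ j ∈ range (n + 1), C (hermiteInvCoeff n j) * gorzHermite j := by
  induction n with
  | zero => simp [hermiteInvCoeff_self]
  | succ n ih =>
    -- `X^{n+1} = ∑_j b(n,j) X H_j = ∑_j b(n,j) (H_{j+1} + 2j H_{j-1})`
    rw [pow_succ, ih, sum_mul]
    have step : ∀ j ∈ range (n + 1), C (hermiteInvCoeff n j) * gorzHermite j * X =
        C (hermiteInvCoeff n j) * gorzHermite (j + 1)
          + C (hermiteInvCoeff n j * (2 * (j : ℝ))) * gorzHermite (j - 1) := by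
      intro j _
      rw [mul_assoc, mul_comm (gorzHermite j) X, X_mul_gorzHermite, mul_add, ← mul_assoc, ← C_mul]
    rw [sum_congr rfl step, sum_add_distrib]
    -- first sum: shift up; second sum: shift down (the `j = 0` term vanishes), then pad with zeros
    have h1 : ∑ j ∈ range (n + 1), C (hermiteInvCoeff n j) * gorzHermite (j + 1) =
        ∑ i ∈ range (n + 2), C (if i = 0 then 0 else hermiteInvCoeff n (i - 1)) * gorzHermite i := by
      rw [sum_range_succ' (fun i => C (if i = 0 then (0:ℝ) else hermiteInvCoeff n (i - 1)) *
        gorzHermite i) (n + 1)]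
      simp
    have h2 : ∑ j ∈ range (n + 1), C (hermiteInvCoeff n j * (2 * (j : ℝ))) * gorzHermite (j - 1) =
        ∑ i ∈ range (n + 2), C (2 * ((i : ℝ) + 1) * hermiteInvCoeff n (i + 1)) * gorzHermite i := by
      rw [sum_range_succ']
      simp only [Nat.cast_zero, mul_zero, map_zero, zero_mul, add_zero, Nat.add_sub_cancel,
        Nat.cast_succ]
      rw [sum_range_succ, sum_range_succ, hermiteInvCoeff_of_lt (by omega : n < n + 1),
        hermiteInvCoeff_of_lt (by omega : n < n + 1 + 1)]
      simp only [mul_zero, map_zero, zero_mul, add_zero]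
      refine sum_congr rfl fun i _ => ?_
      congr 2; ring
    rw [h1, h2, ← sum_add_distrib]
    refine sum_congr rfl fun i _ => ?_
    rw [← add_mul, ← C_add, hermiteInvCoeff_succ]

/-! ### From the monomial basis to the Hermite basis: GORTTW's coefficients (2.7) -/

/-- The Hermite coefficients of a polynomial given in the monomial basis `∑_{k≤d} A_k X^{d-k}`:
`c_j := ∑_{k≤d} hermiteInvCoeff (d-k) (d-j) · A_k`, the coefficient of `H_{d-j}(X/2)`. Only the
terms `k = j - 2i` (`i ≤ j/2`) are nonzero, with `hermiteInvCoeff (d-j+2i) (d-j) = (d-j+2i)!/(i!(d-j)!)`,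
so `c_j = ∑_{i≤⌊j/2⌋} (d-j+2i)!/(i!(d-j)!) A_{j-2i}` — GORTTW's `c_{d,n,j}` when `A_k = A_{d,k}(n)`.
[cite: GriffinEtAl2022, (2.7)] -/
def monomialToHermite (d : ℕ) (A : ℕ → ℝ) (j : ℕ) : ℝ :=
  ∑ k ∈ range (d + 1), hermiteInvCoeff (d - k) (d - j) * A k

/-- **GORTTW (2.7), proved**: `∑_{k≤d} A_k X^{d-k} = ∑_{j≤d} c_j H_{d-j}(X/2)` with
`c_j = monomialToHermite d A j`. [cite: GriffinEtAl2022, (2.7) and proof of Lemma 2.4] -/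
theorem sum_C_mul_X_pow_eq_sum_gorzHermite (d : ℕ) (A : ℕ → ℝ) :
    ∑ k ∈ range (d + 1), C (A k) * X ^ (d - k) =
      ∑ j ∈ range (d + 1), C (monomialToHermite d A j) * gorzHermite (d - j) := by
  -- expand each `X^{d-k}` in the Hermite basis, padding the inner sum to `range (d+1)`
  have hpad : ∀ k ∈ range (d + 1), C (A k) * (X : ℝ[X]) ^ (d - k) =
      ∑ m ∈ range (d + 1), C (A k * hermiteInvCoeff (d - k) m) * gorzHermite m := by
    intro k hk
    have hk' := mem_range.mp hk
    rw [X_pow_eq_sum_gorzHermite, mul_sum]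
    rw [← sum_subset (range_subset_range.mpr (show d - k + 1 ≤ d + 1 by omega))]
    · refine sum_congr rfl fun m _ => ?_
      rw [← mul_assoc, ← C_mul]
    · intro m hm hm'
      have : d - k < m := by
        have h1 := mem_range.mp hm; rw [mem_range] at hm'; omega
      rw [hermiteInvCoeff_of_lt this]; simp
  rw [sum_congr rfl hpad, sum_comm]
  -- collect the coefficient of each `gorzHermite m`, then reflect `m = d - j`
  have hcollect : ∀ m ∈ range (d + 1),
      ∑ k ∈ range (d + 1), C (A k * hermiteInvCoeff (d - k) m) * gorzHermite m =
        C (∑ k ∈ range (d + 1), hermiteInvCoeff (d - k) m * A k) * gorzHermite m := by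
    intro m _
    rw [← sum_mul, map_sum]
    refine congrArg (· * gorzHermite m) (sum_congr rfl fun k _ => ?_)
    rw [mul_comm]
  rw [sum_congr rfl hcollect]
  rw [← sum_range_reflect (fun j => C (monomialToHermite d A j) * gorzHermite (d - j)) (d + 1)]
  refine sum_congr rfl fun m hm => ?_
  have hm' := mem_range.mp hm
  simp only [monomialToHermite]
  rw [show d + 1 - 1 - m = d - m from by omega, show d - (d - m) = m from by omega]

/-- `c₀ = A₀`. [cite: GriffinEtAl2022, (2.7)] -/
theorem monomialToHermite_zero (d : ℕ) (A : ℕ → ℝ) : monomialToHermite d A 0 = A 0 := by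
  rw [monomialToHermite, sum_range_succ', sum_eq_zero]
  · simp [hermiteInvCoeff_self]
  · intro k hk
    rw [hermiteInvCoeff_of_lt (by have := mem_range.mp hk; omega)]; simp

/-- `c₁ = A₁` (`d ≥ 1`). [cite: GriffinEtAl2022, (2.7)] -/
theorem monomialToHermite_one {d : ℕ} (hd : 1 ≤ d) (A : ℕ → ℝ) :
    monomialToHermite d A 1 = A 1 := by
  obtain ⟨e, rfl⟩ : ∃ e, d = e + 1 := ⟨d - 1, by omega⟩
  rw [monomialToHermite, sum_range_succ', sum_range_succ', sum_eq_zero]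
  · simp only [Nat.sub_zero, zero_add, Nat.add_sub_cancel]
    rw [hermiteInvCoeff_self]
    have : hermiteInvCoeff (e + 1) e = 0 := by
      unfold hermiteInvCoeff
      rw [if_neg]; rintro ⟨-, ⟨s, hs⟩⟩; omega
    rw [this]; simp
  · intro k hk
    rw [hermiteInvCoeff_of_lt (by have := mem_range.mp hk; omega)]; simp

/-- `c₂ = A₂ + d(d-1) A₀` (`d ≥ 2`); so `A₀ = 1`, `A₂ = -d(d-1)` give `c₂ = 0`
([GriffinEtAl2022, Lemma 2.2 ⇒ c_{d,n,2} = 0]). [cite: GriffinEtAl2022, (2.7)] -/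
theorem monomialToHermite_two {d : ℕ} (hd : 2 ≤ d) (A : ℕ → ℝ) :
    monomialToHermite d A 2 = A 2 + (d : ℝ) * ((d : ℝ) - 1) * A 0 := by
  obtain ⟨e, rfl⟩ : ∃ e, d = e + 2 := ⟨d - 2, by omega⟩
  rw [monomialToHermite, sum_range_succ', sum_range_succ', sum_range_succ', sum_eq_zero]
  · simp only [Nat.sub_zero, zero_add, Nat.add_sub_cancel, show e + 2 - 1 = e + 1 from rfl]
    rw [hermiteInvCoeff_self]
    have h1 : hermiteInvCoeff (e + 1) e = 0 := by
      unfold hermiteInvCoeff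
      rw [if_neg]; rintro ⟨-, ⟨s, hs⟩⟩; omega
    have h2 : hermiteInvCoeff (e + 2) e = ((e + 2 : ℕ) : ℝ) * (((e + 2 : ℕ) : ℝ) - 1) := by
      unfold hermiteInvCoeff
      rw [if_pos ⟨by omega, ⟨1, by omega⟩⟩, show (e + 2 - e) / 2 = 1 from by omega,
        Nat.factorial_succ, Nat.factorial_succ, Nat.factorial_one]
      have he : (e ! : ℝ) ≠ 0 := by positivity
      push_cast
      field_simp
      ring
    rw [h1, h2]; push_cast; ring
  · intro k hk
    rw [hermiteInvCoeff_of_lt (by have := mem_range.mp hk; omega)]; simp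

/-- **GORTTW's Lemma 2.4 with monomial input, proved**: if a real polynomial
`∑_{k≤d} A_k X^{d-k}` (`d ≥ 2`) has `A₀ = 1`, `A₂ = -d(d-1)` — the shape of `J̃^{d,n}`
[GriffinEtAl2022, (2.6), Lemma 2.2] — and its Hermite coefficients `c_j = monomialToHermite d A j`
((2.7)) satisfy `∑_{j=3}^{d} 2^{-j}(d-j)!/(d-1)! c_j² < 1` ((2.5)), then it equals
`∏_{i<d} (X - tᵢ)` with `t₀ < ⋯ < t_{d-1}`: hyperbolic with simple zeros.
[cite: GriffinEtAl2022, Lemma 2.4] -/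
theorem exists_eq_prod_of_turanSum_monomial_lt_one {d : ℕ} (hd : 2 ≤ d) (A : ℕ → ℝ)
    (hA0 : A 0 = 1) (hA2 : A 2 = -((d : ℝ) * ((d : ℝ) - 1)))
    (hT : turanSum d (monomialToHermite d A) < 1) :
    ∃ t : Fin d → ℝ, StrictMono t ∧
      ∑ k ∈ range (d + 1), C (A k) * X ^ (d - k) = ∏ i, (X - C (t i)) := by
  have h0 : monomialToHermite d A 0 = 1 := by rw [monomialToHermite_zero, hA0]
  have h2 : monomialToHermite d A 2 = 0 := by rw [monomialToHermite_two hd, hA2, hA0]; ring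
  obtain ⟨t, ht, hprod⟩ := exists_eq_prod_of_turanSum_lt_one hd (monomialToHermite d A) h0 h2 hT
  exact ⟨t, ht, by rw [sum_C_mul_X_pow_eq_sum_gorzHermite, hprod]⟩

end Literature.NumberTheory.LFunctions
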